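import Literature.AnabelianGeometry.AbsoluteAnabelian.AbsTopIThm26SplitModelInstances
import Literature.AnabelianGeometry.AbsoluteAnabelian.AbsTopIThm26iiStarProofs
import Literature.AnabelianGeometry.AbsoluteAnabelian.AbsAnabLemma114HypothesesZHatModel
import Literature.AnabelianGeometry.EtaleTheta.SettingModelChiSemidirect
import Literature.AnabelianGeometry.EtaleTheta.SettingModelCyclotomicCharacterLevelNontrivial
import Literature.AnabelianGeometry.EtaleTheta.CyclotomeGaloisFixedPoints
import Literature.AnabelianGeometry.EtaleTheta.SettingModelGfpSlim
import HarnessLib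

/-!
# [AbsTopI] Thm 2.6 (ii), (iv) AS TYPED at the χ-TWISTED model `Π := F̂₂ ⋊_χ G_{ℚ_p}` of [EtTh] §1 —
# a NON-TRIVIAL outer Galois action; `δ¹_l(Π) − δ¹_l(G) = 1` for every prime `l` (PROOF-ONLY)

S. Mochizuki, *Topics in Absolute Anabelian Geometry I: Generalities*, J. Math. Sci. Univ. Tokyo
**19** (2012) [AbsTopI], Thm 2.6 (ii) p. 21, (iv) p. 22, proof of (ii) p. 23 ("`δ¹_l(Π) = δ¹_l(G) +
dim_{ℚ_l}(Q_l ⊗ ℚ_l)` [where we recall that `dim_{ℚ_l}(Q_l ⊗ ℚ_l)` is independent of `l`]"; `Q` = the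
maximal torsion-free quotient of `Δ^{ab}` on which `G` acts trivially, [AbsAnab] Lemma 1.1.4 (ii));
manuscript pagination, lit key `paper:url-11ac98ba15fc`.  S. Mochizuki, *The étale theta function …*
(2009) [EtTh] §1 p. 12 ("`Δ_X` … a profinite free group on 2 generators"; the χ-twisted model of the
abc-iut cell, layer L2: `SettingModel.PiHtχ p = F̂₂ ⋊_{θ∘χ} G_{ℚ_p}`, `G_{ℚ_p}` acting on `F̂₂ = ⟨a, b⟩^`
by `a ↦ a`, `b ↦ b^{χ(σ)}`, `χ` the cyclotomic character).

The typed Thm 2.6 predicates (`FundamentalExtension.Thm26ii`, `Thm26iv`; FACT-LIST rows F-0247,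
F-0248, kernel closedness = parametrised) were so far witnessed in the tree only at extensions with
TRIVIAL outer action (point extensions `Δ = 1`; split products `Δ̂ × G_k`,
`AbsTopIThm26SplitModelInstances.lean`).  This proof-only file (no definition, no instance, no named
fact) proves them at the extension `1 → F̂₂ → F̂₂ ⋊_χ G_{ℚ_p} → G_{ℚ_p} → 1`, where the Galois action
on `Δ^{ab} = Ẑ·a ⊕ Ẑ(χ)·b` is that of a (split) Tate-curve Tate module — so that the printed
invariant "`dim Q`" takes the value `1` (the `a`-line), NOT the split value `2`:

* `exists_levelChar_primePow_chi_ne_one` — for every prime `l` the `l`-adic cyclotomic character of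
  `G_{ℚ_p}` is non-trivial: some `σ` has `χ_{l^j}(σ) ≠ 1` (`ℚ_p` has finitely many roots of unity,
  the tree's `exists_exponent_rootsOfUnity_of_finiteDimensional`; `ℚ_p = ℚ̄_p^{G_{ℚ_p}}`);
* **`eq_one_of_chi_invariant`** — hence a continuous character `β : Ẑ → ℤ_l` with `β ∘ χ(σ) = β` for
  all `σ` is TRIVIAL ("`(Ẑ(χ) ⊗ ℤ_l)_{G_{ℚ_p}}` is torsion": write `χ(σ)(1) = wⁿ·m`, `n = l^{j+v}`,
  `v = ord_l β(1)`, by the tree's `ZHatLevel` arithmetic, read `(m − 1)·β(1) ∈ l^{j+v} ℤ_l`, cancel,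
  and find `χ_{l^j}(σ) = m = 1` — against the first bullet);
* `freeProlRank_piHtχ_le` / `succ_le_freeProlRank_piHtχ` / **`freeProlRank_piHtχ`** —
  `δ¹_l(F̂₂ ⋊_χ G_{ℚ_p}) = δ¹_l(G_{ℚ_p}) + 1` for EVERY prime `l`: (≥) the `a`-exponent
  `ê : F̂₂ → Ẑ` is `θ`-invariant (`eHat_twist`) and extends to `Π ↠ Ẑ ↠ ℤ_l`, appended to `G ↠ ℤ_l^N`;
  (≤) abc-iut-L4-d3's `freeProlRank_le_add_of_coinvariants` with `q = ê : Δ ↠ Ẑ ≅ Ẑ^1`: a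
  `Π`-conjugation-invariant character `ψ` of `Δ = F̂₂` has `ψ(b^·) ∘ χ(σ) = ψ(b^·)`, so kills `b` by
  the second bullet, hence factors through `ê` (continuous homomorphisms out of `F̂₂` are determined on
  `η(a), η(b)`, `ext_of_eta`);
* **`thm26iv_chiTwistedModel`**, **`thm26ii_chiTwistedModel_of_tfg`** — the typed (iv) for
  `Σ = Primes` (unconditional) and (ii) for `Σ = Primes` with base datum `(p, ℚ_p, refl)` GIVEN
  "`G_{ℚ_p}` topologically finitely generated" ([NSW] Thm 7.5.10 — a theorem of the tree, Summits-side: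
  `isTopologicallyFinitelyGenerated_absoluteGaloisGroup_padic`; the unconditional form is assembled
  in `Summits/ABC/IUTFork/`).

HONEST FRAMING.  `F̂₂ ⋊_χ G_{ℚ_p}` is the cell's SEMI-SYNTHETIC model (abc-iut-L2, R78 cluster) — it
is NOT `π₁` of a curve (the tree constructs no étale `π₁`, FOUNDATIONS row 12); its Galois action is
the honest cyclotomic one on `b` and trivial on `a`, the abelianised shape of the Tate module of a Tate
curve `0 → Ẑ(1) → T(E_q) → Ẑ → 0` (split here).  A satisfiability witness of the typed (ii) with
NON-TRIVIAL outer action and `dim Q = 1`; (iv) uses no property of the action.  [AbsTopI] and [EtTh]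
are refereed; nothing here bears on [IUTchIII] Cor. 3.12 or takes a side; typed ≠ proved elsewhere.
Theorems only; axioms standard.
-/

noncomputable section

open Topology Field CategoryTheory ProfiniteGrp ProfiniteGrp.ProfiniteCompletion

namespace Literature.AnabelianGeometry.AbsoluteAnabelian

open Literature.AnabelianGeometry.EtaleTheta Literature.AnabelianGeometry.EtaleTheta.SettingModel
open Literature.AnabelianGeometry.SemiGraphs (GQp)
open Literature.AnabelianGeometry.SemiGraphs.SemiGraphOfAnabelioids (IsProSigmaCompletion)
open Literature.IUT.HodgeTheaters (profiniteCompletion toCompletion)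

universe u

/-! ### The `l`-adic cyclotomic character of `G_{ℚ_p}` is non-trivial, for every prime `l` -/

section ChiLevel

variable (p : ℕ) [Fact p.Prime]

/-- An element of `ℚ̄_p` outside `ℚ_p` is moved by some `σ ∈ G_{ℚ_p}` (`ℚ_p` is the fixed field of
`Gal(ℚ̄_p/ℚ_p)`, infinite Galois correspondence). [cite: NeukirchANT1999, Ch. IV §1] -/
theorem exists_algEquiv_apply_ne_of_not_mem_range {ζ : PadicAlgCl p}
    (hζ : ζ ∉ Set.range (algebraMap ℚ_[p] (PadicAlgCl p))) : ∃ σ : GQp p, σ ζ ≠ ζ := by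
  by_contra hall
  haveI : IsGalois ℚ_[p] (PadicAlgCl p) := {}
  have hmem : ζ ∈ IntermediateField.fixedField (⊤ : Subgroup (GQp p)) := by
    rw [IntermediateField.mem_fixedField_iff]
    intro σ _
    by_contra hne
    exact hall ⟨σ, hne⟩
  rw [← IntermediateField.fixingSubgroup_bot, InfiniteGalois.fixedField_fixingSubgroup,
    IntermediateField.mem_bot] at hmem
  exact hζ hmem

/-- **For every prime `l`, the `l`-adic cyclotomic character of `G_{ℚ_p}` is non-trivial**: some
`σ ∈ G_{ℚ_p}` has `χ_{l^j}(σ) ≠ 1` for some `j` — the roots of unity of `ℚ_p` are killed by one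
exponent `M` (Neukirch II (5.7) (i); the tree's `exists_exponent_rootsOfUnity_of_finiteDimensional`), so
a primitive `l^M`-th root of unity of `ℚ̄_p` lies outside `ℚ_p` and is moved by some `σ`, whence
`χ_{l^M}(σ) ≠ 1` (`levelChar_chi_ne_one_of_apply_ne`). [cite: NeukirchANT1999, Ch. II Prop. (5.7) (i)] -/
theorem exists_levelChar_primePow_chi_ne_one (l : ℕ) [hl : Fact l.Prime] :
    ∃ (j : ℕ) (σ : GQp p), ZHatLevel.levelChar ⟨l ^ j, pow_pos hl.out.pos j⟩ (chi p σ) ≠ 1 := by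
  obtain ⟨M, hM, hroots⟩ := exists_exponent_rootsOfUnity_of_finiteDimensional p ℚ_[p]
  obtain ⟨ζ, hζ⟩ := exists_isPrimitiveRoot_padicAlgCl p (l ^ M) (pow_pos hl.out.pos M)
  have hnot : ζ ∉ Set.range (algebraMap ℚ_[p] (PadicAlgCl p)) := by
    rintro ⟨x, hx⟩
    have hxprim : IsPrimitiveRoot x (l ^ M) := by
      rw [← hx] at hζ
      exact hζ.of_map_of_injective (algebraMap ℚ_[p] (PadicAlgCl p)).injective
    have hfin : IsOfFinOrder x :=
      isOfFinOrder_iff_pow_eq_one.mpr ⟨l ^ M, pow_pos hl.out.pos M, hxprim.pow_eq_one⟩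
    have hdvd : l ^ M ∣ M := hxprim.dvd_of_pow_eq_one M (hroots x hfin)
    exact absurd (Nat.le_of_dvd hM hdvd) (not_le.mpr (Nat.lt_pow_self hl.out.one_lt))
  obtain ⟨σ, hσ⟩ := exists_algEquiv_apply_ne_of_not_mem_range p hnot
  exact ⟨M, σ, levelChar_chi_ne_one_of_apply_ne p σ ⟨l ^ M, pow_pos hl.out.pos M⟩ hζ.pow_eq_one hσ⟩

/-! ### `χ`-invariant continuous characters `Ẑ → ℤ_l` are trivial -/

/-- **`(Ẑ(χ) ⊗ ℤ_l)_{G_{ℚ_p}}` has no free part: a continuous character `β : Ẑ → ℤ_l` with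
`β(χ(σ) t) = β(t)` for all `σ ∈ G_{ℚ_p}` and all `t` is trivial.**  Write `c = β(η 1)`; if `c ≠ 1`,
let `v = ord_l(c)`, pick `j, σ` with `χ_{l^j}(σ) ≠ 1` (`exists_levelChar_primePow_chi_ne_one`), put
`n = l^{j+v}` and write `χ(σ)(η 1) = wⁿ · η(m)` (`ZHatLevel.level_eq_one_iff_exists_pow`): applying `β`,
`c = β(w)ⁿ · cᵐ`, i.e. `(m − 1)·c ∈ l^{j+v} ℤ_l`, so `l^j ∣ m − 1`; but `χₙ(σ) = m` (every automorphism
of `Ẑ` acts on `ℤ/n` by the scalar `χₙ`, `toAdd_level_aut`), so `χ_{l^j}(σ) = 1` — contradiction.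
(The dual of the tree's `H⁰(G_{ℚ_p}, Ẑ(χ)) = 1`, `eq_one_of_forall_chi_apply_eq_top`.)
[cite: NeukirchANT1999, Ch. II Prop. (5.7) (i)] -/
theorem eq_one_of_chi_invariant {l : ℕ} [hl : Fact l.Prime] (β : ZH →ₜ* Multiplicative ℤ_[l])
    (hβ : ∀ (σ : GQp p) (t : ZH), β (chi p σ t) = β t) : β = 1 := by
  classical
  obtain ⟨j, σ, hσ⟩ := exists_levelChar_primePow_chi_ne_one p l
  set c : Multiplicative ℤ_[l] := β (ZHatLevel.eta 1) with hc
  by_cases hx : Multiplicative.toAdd c = 0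
  · -- `β (η 1) = 1`, so `β = 1` by density of `η(ℤ)`
    have h := ZHatCompletion.monoidHom_ext_of_continuous (f₁ := β.toMonoidHom)
      (f₂ := (1 : ZH →ₜ* Multiplicative ℤ_[l]).toMonoidHom) β.continuous
      (1 : ZH →ₜ* Multiplicative ℤ_[l]).continuous (by
        change c = 1
        rw [← ofAdd_toAdd c, hx, ofAdd_zero])
    exact ContinuousMonoidHom.ext fun t => DFunLike.congr_fun h t
  · exfalso
    set x : ℤ_[l] := Multiplicative.toAdd c with hxdef
    set v : ℕ := x.valuation with hv
    let n₀ : ℕ+ := ⟨l ^ j, pow_pos hl.out.pos j⟩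
    let n₁ : ℕ+ := ⟨l ^ v, pow_pos hl.out.pos v⟩
    let n : ℕ+ := n₀ * n₁
    have hn : ((n : ℕ) : ℤ_[l]) = (l : ℤ_[l]) ^ j * (l : ℤ_[l]) ^ v := by
      change (((l ^ j * l ^ v : ℕ)) : ℤ_[l]) = _
      push_cast
      rfl
    -- `z := χ(σ)(η 1)`, `β z = c`
    set z : ZH := chi p σ (ZHatLevel.eta 1) with hz
    have hβz : β z = c := hβ σ _
    -- `z = w ^ n * η m`
    obtain ⟨m, hm⟩ := ZHatLevel.exists_level_eq_level_eta n z
    have h1 : ZHatLevel.level n (z * (ZHatLevel.eta m)⁻¹) = 1 := by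
      rw [map_mul, map_inv, hm, mul_inv_cancel]
    obtain ⟨w, hw⟩ := (ZHatLevel.level_eq_one_iff_exists_pow n _).mp h1
    have hzw : z = w ^ (n : ℕ) * ZHatLevel.eta m := by rw [hw, inv_mul_cancel_right]
    -- additively: `x = n • β(w) + m • x`
    have hadd : x = ((n : ℕ) : ℤ_[l]) * Multiplicative.toAdd (β w) + (m : ℤ_[l]) * x := by
      have h2 := hβz
      rw [hzw, map_mul, map_pow, ZHatLevel.eta_eq_zpow m, map_zpow] at h2
      have h3 := congrArg Multiplicative.toAdd h2
      rw [toAdd_mul, toAdd_pow, toAdd_zpow, nsmul_eq_mul, zsmul_eq_mul] at h3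
      exact h3.symm
    -- hence `l^j * l^v ∣ (m - 1) * x`
    have hdvd : (l : ℤ_[l]) ^ j * (l : ℤ_[l]) ^ v ∣ ((m : ℤ_[l]) - 1) * x := by
      refine ⟨-Multiplicative.toAdd (β w), ?_⟩
      rw [← hn]
      linear_combination (-1 : ℤ_[l]) * hadd
    -- `x = u * l^v`, cancel: `l^j ∣ m - 1`
    have hxv : x = (PadicInt.unitCoeff hx : ℤ_[l]) * (l : ℤ_[l]) ^ v := PadicInt.unitCoeff_spec hx
    have hdvd' : (l : ℤ_[l]) ^ j ∣ ((m : ℤ_[l]) - 1) := by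
      rw [hxv, ← mul_assoc] at hdvd
      have hl0 : (l : ℤ_[l]) ^ v ≠ 0 := pow_ne_zero _ (by exact_mod_cast hl.out.ne_zero)
      have h3 : (l : ℤ_[l]) ^ j ∣ ((m : ℤ_[l]) - 1) * (PadicInt.unitCoeff hx : ℤ_[l]) :=
        (mul_dvd_mul_iff_right hl0).mp hdvd
      exact (Units.isUnit _).dvd_mul_right.mp h3
    have hdvdZ : ((l ^ j : ℕ) : ℤ) ∣ m - 1 := by
      rw [Nat.cast_pow, ← PadicInt.pow_p_dvd_int_iff]
      push_cast
      exact hdvd'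
    -- `χ_n(σ) = m`
    have hlev : ZHatLevel.levelChar n (chi p σ) = (m : ZMod n) := by
      have h := ZHatLevel.toAdd_level_aut n (chi p σ) (ZHatLevel.eta 1)
      rw [ZHatLevel.level_eta, toAdd_ofAdd, Int.cast_one, mul_one] at h
      rw [← h, ← hz, hm, ZHatLevel.level_eta, toAdd_ofAdd]
    -- `χ_{l^j}(σ) = m = 1`
    have hcast : ZHatLevel.levelChar n₀ (chi p σ) = ((m : ℤ) : ZMod n₀) := by
      rw [← ZHatLevel.cast_levelChar_mul n₀ n₁ (chi p σ)]
      change ZMod.castHom (dvd_mul_right (n₀ : ℕ) n₁) (ZMod n₀) (ZHatLevel.levelChar n (chi p σ)) = _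
      rw [hlev]
      exact map_intCast (ZMod.castHom (dvd_mul_right (n₀ : ℕ) n₁) (ZMod n₀)) m
    have hm1 : ((m : ℤ) : ZMod n₀) = 1 := by
      have h4 : ((l ^ j : ℕ) : ℤ) ∣ -(m - 1) := (dvd_neg).mpr hdvdZ
      rw [neg_sub] at h4
      rw [← Int.cast_one]
      exact (ZMod.intCast_eq_intCast_iff_dvd_sub m 1 n₀).mpr h4
    exact hσ (hcast.trans hm1)

end ChiLevel

/-! ### Free pro-`l` ranks of `F̂₂ ⋊_χ G_{ℚ_p}` -/

section Rank

variable (p : ℕ) [Fact p.Prime]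

/-- `ê : F̂₂ → Ẑ` (the `a`-exponent sum) is surjective: its compact image contains the dense `ι(ℤ)`
(`ê(η g) = ι(expA g)`, `expA` surjective). [cite: MochizukiEtTh2009, §1 p.12] -/
theorem eHat_surjective : Function.Surjective (eHat : F₂hatT → ZH) := by
  have hcl : IsClosed (Set.range (eHat : F₂hatT → ZH)) := (isCompact_range eHat.continuous).isClosed
  have hsub : Set.range (iotaZ : Multiplicative ℤ → ZH) ⊆ Set.range (eHat : F₂hatT → ZH) := by
    rintro _ ⟨k, rfl⟩
    obtain ⟨g, hg⟩ := expA_surjective k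
    exact ⟨SettingModel.eta g, by rw [eHat_eta, hg]⟩
  have hdense : DenseRange (iotaZ : Multiplicative ℤ → ZH) :=
    ProfiniteGrp.ProfiniteCompletion.denseRange (GrpCat.of (Multiplicative ℤ))
  intro t
  have ht : t ∈ closure (Set.range (iotaZ : Multiplicative ℤ → ZH)) :=
    hdense.closure_range ▸ Set.mem_univ t
  exact hcl.closure_subset_iff.mpr hsub ht

/-- A continuous homomorphism `Ẑ → ℤ_l` (multiplicative notation) with `η(1) ↦ 1` is surjective
(compact image containing the dense `ℕ ⊆ ℤ_l`). [cite: RibesZalesskii2010, Thm 2.7.1] -/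
theorem surjective_of_apply_eta_one {l : ℕ} [Fact l.Prime] (π : ZH →ₜ* Multiplicative ℤ_[l])
    (hπ : π (ZHatLevel.eta 1) = Multiplicative.ofAdd 1) : Function.Surjective π := by
  have hcl : IsClosed (Set.range (π : ZH → Multiplicative ℤ_[l])) :=
    (isCompact_range π.continuous).isClosed
  let f : ℕ → Multiplicative ℤ_[l] := fun k => Multiplicative.ofAdd ((k : ℤ_[l]))
  have hsub : Set.range f ⊆ Set.range (π : ZH → Multiplicative ℤ_[l]) := by
    rintro _ ⟨k, rfl⟩
    refine ⟨ZHatLevel.eta 1 ^ k, ?_⟩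
    rw [map_pow, hπ, ← ofAdd_nsmul, nsmul_eq_mul, mul_one]
  have hdense : DenseRange f :=
    Multiplicative.ofAdd.surjective.denseRange.comp (PadicInt.denseRange_natCast (p := l))
      continuous_ofAdd
  intro y
  have hy : y ∈ closure (Set.range f) := hdense.closure_range ▸ Set.mem_univ y
  exact hcl.closure_subset_iff.mpr hsub hy

/-- **`n ≤ δ¹_l(G_{ℚ_p}) ⇒ n + 1 ≤ δ¹_l(F̂₂ ⋊_χ G_{ℚ_p})`.**  The `a`-exponent `ê : F̂₂ → Ẑ` is
invariant under the twists `θ_u` (`eHat_twist`), so `g ↦ ê(g.left)` is a continuous homomorphism on the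
semidirect product; composed with `Ẑ ↠ ℤ_l` (`η(1) ↦ 1`) and appended to a continuous surjection
`G_{ℚ_p} ↠ ℤ_l^N` it gives `Π ↠ ℤ_l^{N+1}`. [cite: MochizukiAbsTopI2012, Thm 2.6 (ii) p.21] -/
theorem succ_le_freeProlRank_piHtχ (l : ℕ) [Fact l.Prime] {N : ℕ}
    (hN : (N : ℕ∞) ≤ freeProlRank (GQp p) l) :
    ((N + 1 : ℕ) : ℕ∞) ≤ freeProlRank (PiHtχ p) l := by
  -- a continuous surjection `G ↠ ℤ_l^M` with `N ≤ M`
  obtain ⟨M, F, hNM, hF⟩ : ∃ (M : ℕ) (F : GQp p →ₜ* Multiplicative (Fin M → ℤ_[l])),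
      N ≤ M ∧ Function.Surjective F := by
    rcases Nat.eq_zero_or_pos N with rfl | hN0
    · refine ⟨0, ⟨1, continuous_const⟩, le_rfl, fun y => ⟨1, ?_⟩⟩
      apply Multiplicative.toAdd.injective
      funext i
      exact i.elim0
    · exact exists_surjective_of_le_freeProlRank l hN0 hN
  -- `Ẑ ↠ ℤ_l`, `η(1) ↦ 1`
  obtain ⟨πl, hπl⟩ := ZHatCompletion.exists_continuousMonoidHom_apply_eq
    (P := Multiplicative ℤ_[l]) (Multiplicative.ofAdd (1 : ℤ_[l]))
  have hπls : Function.Surjective πl := surjective_of_apply_eta_one πl hπl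
  -- the character `g ↦ πl (ê g.left)` of the semidirect product
  let lam : PiHtχ p →ₜ* Multiplicative ℤ_[l] :=
    { toFun := fun g => πl (eHat g.left)
      map_one' := by simp only [SemidirectProduct.one_left, map_one]
      map_mul' := fun g h => by
        simp only [SemidirectProduct.mul_left, map_mul, actHatχ_apply, eHat_twist]
      continuous_toFun := πl.continuous.comp (eHat.continuous.comp
        (Semidirect.continuous_left (isInducing_leftRightHatχ p))) }
  have hlam : ∀ g : PiHtχ p, lam g = πl (eHat g.left) := fun _ => rfl
  -- append: `g ↦ (lam g, F g.right) ∈ ℤ_l^{M+1}`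
  let Φ : PiHtχ p →ₜ* Multiplicative (Fin (M + 1) → ℤ_[l]) :=
    { toFun := fun g => Multiplicative.ofAdd
        (Fin.cons (Multiplicative.toAdd (lam g)) (Multiplicative.toAdd (F g.right)) :
          Fin (M + 1) → ℤ_[l])
      map_one' := by
        change Multiplicative.ofAdd _ = Multiplicative.ofAdd 0
        congr 1
        funext i
        refine Fin.cases ?_ (fun j => ?_) i
        · rw [Fin.cons_zero, map_one, toAdd_one, Pi.zero_apply]
        · rw [Fin.cons_succ, SemidirectProduct.one_right, map_one, toAdd_one, Pi.zero_apply,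
            Pi.zero_apply]
      map_mul' := fun x y => by
        rw [← ofAdd_add]
        congr 1
        funext i
        refine Fin.cases ?_ (fun j => ?_) i
        · rw [Pi.add_apply, Fin.cons_zero, Fin.cons_zero, Fin.cons_zero, map_mul, toAdd_mul]
        · rw [Pi.add_apply, Fin.cons_succ, Fin.cons_succ, Fin.cons_succ, SemidirectProduct.mul_right,
            map_mul, toAdd_mul, Pi.add_apply]
      continuous_toFun := continuous_ofAdd.comp
        (Continuous.finCons (A := fun _ : Fin (M + 1) => ℤ_[l])
          (continuous_toAdd.comp lam.continuous)
          (continuous_toAdd.comp (F.continuous.comp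
            (Semidirect.continuous_right (isInducing_leftRightHatχ p))))) }
  have hΦ_apply : ∀ g : PiHtχ p, Multiplicative.toAdd (Φ g) =
      (Fin.cons (Multiplicative.toAdd (lam g)) (Multiplicative.toAdd (F g.right)) :
        Fin (M + 1) → ℤ_[l]) := fun _ => rfl
  have hΦ : Function.Surjective Φ := by
    intro y
    obtain ⟨σ, hσ⟩ := hF (Multiplicative.ofAdd (Fin.tail (Multiplicative.toAdd y)))
    obtain ⟨t, ht⟩ := hπls (Multiplicative.ofAdd (Multiplicative.toAdd y 0))
    obtain ⟨x, hx⟩ := eHat_surjective t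
    refine ⟨⟨x, σ⟩, ?_⟩
    apply Multiplicative.toAdd.injective
    rw [hΦ_apply, hlam]
    change (Fin.cons (Multiplicative.toAdd (πl (eHat x))) (Multiplicative.toAdd (F σ)) :
      Fin (M + 1) → ℤ_[l]) = _
    rw [hx, ht, hσ, toAdd_ofAdd, toAdd_ofAdd, Fin.cons_self_tail]
  calc ((N + 1 : ℕ) : ℕ∞) ≤ ((M + 1 : ℕ) : ℕ∞) := by exact_mod_cast Nat.succ_le_succ hNM
    _ ≤ freeProlRank (PiHtχ p) l := le_freeProlRank_of_surjective l Φ hΦ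

/-- **`δ¹_l(F̂₂ ⋊_χ G_{ℚ_p}) ≤ δ¹_l(G_{ℚ_p}) + 1`** — abc-iut-L4-d3's `freeProlRank_le_add_of_coinvariants`
for `Π ↠ G` with `q := ê : Δ = F̂₂ ↠ Ẑ ≅ Ẑ^1`: a `Π`-conjugation-invariant continuous character
`ψ : Δ → ℤ_l` satisfies `ψ(b^{χ(σ) t}) = ψ(b^t)`, so `ψ ∘ b^· = 1` (`eq_one_of_chi_invariant`), i.e.
`ψ(η b) = 1`; hence `ψ = Φ ∘ ê` for the continuous `Φ : Ẑ → ℤ_l` with `Φ(η 1) = ψ(η a)` (continuous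
homomorphisms out of `F̂₂` are determined on `η a, η b`, `ext_of_eta`), and `ψ` kills `Ker(ê) = Ker(q)`.
[cite: MochizukiAbsTopI2012, Thm 2.6 (ii) p.21] [cite: MochizukiAbsAnab2004, Lemma 1.1.4 (ii) proof p.8] -/
theorem freeProlRank_piHtχ_le (l : ℕ) [Fact l.Prime] :
    freeProlRank (PiHtχ p) l ≤ freeProlRank (GQp p) l + 1 := by
  haveI : CompactSpace (GQp p) := compactSpace_GQp p
  haveI : T2Space (GQp p) := krullTopology_t2
  let D : Subgroup (PiHtχ p) := (augHatχ p).toMonoidHom.ker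
  have hD : ∀ x, x ∈ D ↔ augHatχ p x = 1 := fun _ => Iff.rfl
  haveI hDn : D.Normal := MonoidHom.normal_ker _
  -- `Ẑ^1 ≅ Ẑ`
  obtain ⟨e₁⟩ := FundamentalExtension.nonempty_hatZPow_one_continuousMulEquiv_zHatCompletion
  -- `Δ → F̂₂`, `d ↦ d.left` (a homomorphism since `d.right = 1`)
  let leftD : D →ₜ* F₂hatT :=
    { toFun := fun d => (d : PiHtχ p).left
      map_one' := rfl
      map_mul' := fun d d' => by
        change ((d : PiHtχ p) * (d' : PiHtχ p)).left = _
        rw [SemidirectProduct.mul_left, show (d : PiHtχ p).right = 1 from (hD _).mp d.2, map_one,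
          MulAut.one_apply]
      continuous_toFun := (Semidirect.continuous_left (isInducing_leftRightHatχ p)).comp
        continuous_subtype_val }
  -- `F̂₂ → Δ`, `x ↦ (x, 1)`
  let inlD : F₂hatT →ₜ* D :=
    { toFun := fun x => ⟨SemidirectProduct.inl x, rfl⟩
      map_one' := Subtype.ext (map_one _)
      map_mul' := fun x y => Subtype.ext (map_mul _ x y)
      continuous_toFun := (Semidirect.continuous_inl (isInducing_leftRightHatχ p)).subtype_mk _ }
  -- `q := Δ ↠ F̂₂ ↠ Ẑ ≅ Ẑ^1`
  let toHatZ : ZH →ₜ* FundamentalExtension.HatZPow 1 :=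
    ⟨e₁.symm.toMulEquiv.toMonoidHom, map_continuous e₁.symm⟩
  let q : D →ₜ* FundamentalExtension.HatZPow 1 := toHatZ.comp (eHat.comp leftD)
  have hq_apply : ∀ d : D, q d = e₁.symm (eHat ((d : PiHtχ p).left)) := fun _ => rfl
  have hq : Function.Surjective q := by
    intro y
    obtain ⟨x, hx⟩ := eHat_surjective (e₁ y)
    refine ⟨inlD x, ?_⟩
    rw [hq_apply]
    change e₁.symm (eHat x) = y
    rw [hx, ContinuousMulEquiv.symm_apply_apply]
  refine freeProlRank_le_add_of_coinvariants (augHatχ p) (fun σ => ⟨SemidirectProduct.inr σ, rfl⟩)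
    D hD q hq l ?_
  intro ψ hψ d hqd
  -- `ψ' := ψ ∘ inl : F̂₂ → ℤ_l`
  let ψ' : F₂hatT →ₜ* Multiplicative ℤ_[l] := ψ.comp inlD
  have hψ'_apply : ∀ x, ψ' x = ψ (inlD x) := fun _ => rfl
  -- invariance under the twists `θ_{χ(σ)}`
  have hinv : ∀ (σ : GQp p) (x : F₂hatT), ψ' (twist (chi p σ) x) = ψ' x := by
    intro σ x
    have h := hψ (SemidirectProduct.inr σ) (inlD x)
    have heq : (⟨SemidirectProduct.inr σ * (inlD x : PiHtχ p) * (SemidirectProduct.inr σ)⁻¹,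
        hDn.conj_mem _ (inlD x).2 _⟩ : D) = inlD (twist (chi p σ) x) := by
      apply Subtype.ext
      change SemidirectProduct.inr σ * SemidirectProduct.inl x * (SemidirectProduct.inr σ)⁻¹ =
        SemidirectProduct.inl (twist (chi p σ) x)
      rw [← map_inv, ← actHatχ_apply, SemidirectProduct.inl_aut]
    rw [heq] at h
    rw [hψ'_apply, hψ'_apply]
    exact h
  -- Step A: `ψ'` kills `η b`
  have hb : ψ' (SettingModel.eta (FreeGroup.of 1)) = 1 := by
    have hβ := eq_one_of_chi_invariant p (ψ'.comp bPow) (fun σ t => by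
      change ψ' (bPow (chi p σ t)) = ψ' (bPow t)
      rw [← twist_bPow, hinv])
    have h := DFunLike.congr_fun hβ (iotaZ (Multiplicative.ofAdd 1))
    change ψ' (bPow (iotaZ (Multiplicative.ofAdd 1))) = 1 at h
    rwa [bPow_iotaZ_one] at h
  -- Step B: `ψ' = Φ ∘ ê`
  obtain ⟨Φa, hΦa⟩ := ZHatCompletion.exists_continuousMonoidHom_apply_eq
    (P := Multiplicative ℤ_[l]) (ψ' (SettingModel.eta (FreeGroup.of 0)))
  have hfac : ψ' = Φa.comp eHat := by
    refine ext_of_eta ?_ ?_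
    · change ψ' (SettingModel.eta (FreeGroup.of 0)) = Φa (eHat (SettingModel.eta (FreeGroup.of 0)))
      rw [eHat_eta, expA_of_zero, iotaZ_one_eq]
      exact hΦa.symm
    · change ψ' (SettingModel.eta (FreeGroup.of 1)) = Φa (eHat (SettingModel.eta (FreeGroup.of 1)))
      rw [hb, eHat_eta, expA_of_one, map_one, map_one]
  -- conclude: `d = (d.left, 1)`, `ê(d.left) = 1`
  have hd1 : (d : PiHtχ p).right = 1 := (hD _).mp d.2
  have hdeq : d = inlD ((d : PiHtχ p).left) := by
    apply Subtype.ext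
    change (d : PiHtχ p) = SemidirectProduct.inl ((d : PiHtχ p).left)
    rw [← SemidirectProduct.inl_left_mul_inr_right (d : PiHtχ p), hd1, map_one, mul_one]
    rfl
  have hq1 : eHat ((d : PiHtχ p).left) = 1 := by
    rw [hq_apply, map_eq_one_iff _ e₁.symm.injective] at hqd
    exact hqd
  rw [hdeq, ← hψ'_apply, hfac]
  change Φa (eHat ((SemidirectProduct.inl ((d : PiHtχ p).left) : PiHtχ p).left)) = 1
  rw [SemidirectProduct.left_inl, hq1, map_one]

/-- **`δ¹_l(F̂₂ ⋊_χ G_{ℚ_p}) = δ¹_l(G_{ℚ_p}) + 1` for every prime `l`** — the printed rank identity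
"`δ¹_l(Π) = δ¹_l(G) + dim_{ℚ_l}(Q_l ⊗ ℚ_l)`, independent of `l`" (proof of Thm 2.6 (ii), p. 23) at the
χ-twisted model, with `dim Q = 1`: of `Δ^{ab} = Ẑ·a ⊕ Ẑ(χ)·b` only the `a`-line survives in the
`G`-coinvariants. [cite: MochizukiAbsTopI2012, Thm 2.6 (ii) p.21] -/
theorem freeProlRank_piHtχ (l : ℕ) [Fact l.Prime] :
    freeProlRank (PiHtχ p) l = freeProlRank (GQp p) l + 1 := by
  refine le_antisymm (freeProlRank_piHtχ_le p l) ?_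
  rcases eq_or_ne (freeProlRank (GQp p) l) ⊤ with htop | hne
  · have h := freeProlRank_le_of_surjective (augHatχ p)
      (fun σ => ⟨SemidirectProduct.inr σ, rfl⟩) l
    rw [htop, top_le_iff] at h
    rw [h]
    exact le_top
  · obtain ⟨N, hN⟩ := ENat.ne_top_iff_exists.mp hne
    rw [← hN]
    exact_mod_cast succ_le_freeProlRank_piHtχ p l hN.le

end Rank

/-! ### [AbsTopI] Thm 2.6 (ii), (iv) at `1 → F̂₂ → F̂₂ ⋊_χ G_{ℚ_p} → G_{ℚ_p} → 1` -/

namespace FundamentalExtension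

variable (p : ℕ) [Fact p.Prime]

/-- `Δ = F̂₂ ⋊ 1 ≅ F̂₂` for the extension `F̂₂ ⋊_χ G_{ℚ_p} ↠ G_{ℚ_p}` (`x ↦ (x, 1)`).
[cite: MochizukiEtTh2009, §1 p.12] -/
theorem exists_continuousMulEquiv_geom_chiTwisted :
    ∃ e : F₂hatT ≃ₜ* (⟨ProfiniteGrp.of (PiHtχ p), absoluteGaloisGrp ℚ_[p], augHatχ p,
        fun σ => ⟨SemidirectProduct.inr σ, rfl⟩⟩ : FundamentalExtension.{0}).geom,
      ∀ x, ((e x : (⟨ProfiniteGrp.of (PiHtχ p), absoluteGaloisGrp ℚ_[p], augHatχ p,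
        fun σ => ⟨SemidirectProduct.inr σ, rfl⟩⟩ : FundamentalExtension.{0}).geom) : PiHtχ p) =
          SemidirectProduct.inl x := by
  let E : FundamentalExtension.{0} := ⟨ProfiniteGrp.of (PiHtχ p), absoluteGaloisGrp ℚ_[p], augHatχ p,
    fun σ => ⟨SemidirectProduct.inr σ, rfl⟩⟩
  have hmem : ∀ g : PiHtχ p, g ∈ E.geom ↔ g.right = 1 := fun _ => Iff.rfl
  let e : F₂hatT ≃ₜ* E.geom :=
    { toFun := fun x => ⟨SemidirectProduct.inl x, (hmem _).mpr rfl⟩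
      invFun := fun y => (y : PiHtχ p).left
      left_inv := fun _ => rfl
      right_inv := fun y => by
        apply Subtype.ext
        change SemidirectProduct.inl ((y : PiHtχ p).left) = (y : PiHtχ p)
        rw [← SemidirectProduct.inl_left_mul_inr_right (y : PiHtχ p), (hmem _).mp y.2, map_one,
          mul_one]
        rfl
      map_mul' := fun x y => Subtype.ext (map_mul _ x y)
      continuous_toFun := (Semidirect.continuous_inl (isInducing_leftRightHatχ p)).subtype_mk _
      continuous_invFun :=
        (Semidirect.continuous_left (isInducing_leftRightHatχ p)).comp continuous_subtype_val }
  exact ⟨e, fun _ => rfl⟩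

/-- **[AbsTopI] Thm 2.6 (iv) AS TYPED at the χ-twisted model** (`Σ = Primes`): every almost
pro-omissive topologically finitely generated closed normal subgroup of `F̂₂ ⋊_χ G_{ℚ_p}` lies in
`Δ = F̂₂` — `MLFBase.thm26iv` (elasticity of `G_{ℚ_p}`, Thm 1.7 (ii), a theorem of the tree) with
Prop 2.2 at the model (`F̂₂` is topologically generated by `η a, η b`). Unconditional.
[cite: MochizukiAbsTopI2012, Thm 2.6 (iv) p.22] -/
theorem thm26iv_chiTwistedModel :
    Literature.AnabelianGeometry.AbsoluteAnabelian.FundamentalExtension.Thm26iv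
      ⟨ProfiniteGrp.of (PiHtχ p), absoluteGaloisGrp ℚ_[p], augHatχ p,
        fun σ => ⟨SemidirectProduct.inr σ, rfl⟩⟩ {q | q.Prime} := by
  obtain ⟨e, -⟩ := exists_continuousMulEquiv_geom_chiTwisted p
  have hF : IsTopologicallyFinitelyGenerated F₂hatT :=
    (IsProSigmaCompletion.isProSigmaCompletion_toCompletion F₂).isTopologicallyFinitelyGenerated_of_fg
  exact MLFBase.thm26iv { p := p, K := ℚ_[p], galIso := ContinuousMulEquiv.refl _ }
    (hF.of_continuousMulEquiv e) subset_rfl ⟨fun U _ _ q hq _ => hq⟩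

/-- **[AbsTopI] Thm 2.6 (ii) AS TYPED at the χ-twisted model `F̂₂ ⋊_χ G_{ℚ_p} ↠ G_{ℚ_p}`**, base
datum `(p, ℚ_p, refl)`, `Σ = Primes`, GIVEN "`G_{ℚ_p}` topologically finitely generated" ([NSW] Thm
7.5.10, the printed input of the proof p. 23; a theorem of the tree Summits-side): "`Π` topologically
finitely generated" (extension of tfg by tfg); the `G`-clauses and "`ε¹_p(Π) = ∞`" (theorems,
`thm26ii_of_clauses`); "`δ¹_l(Π) − δ¹_l(G)` independent of `l ∈ Σ`": it is `1` for every `l`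
(`freeProlRank_piHtχ`) — with a NON-TRIVIAL outer Galois action (`χ ≠ 1` on every open subgroup,
`SettingModelCyclotomicCharacterNontrivial`).  HONEST LABEL: semi-synthetic model, not a curve's `π₁`.
[cite: MochizukiAbsTopI2012, Thm 2.6 (ii) p.21] -/
theorem thm26ii_chiTwistedModel_of_tfg (hG : IsTopologicallyFinitelyGenerated (GQp p)) :
    Literature.AnabelianGeometry.AbsoluteAnabelian.FundamentalExtension.Thm26ii
      ⟨ProfiniteGrp.of (PiHtχ p), absoluteGaloisGrp ℚ_[p], augHatχ p,
        fun σ => ⟨SemidirectProduct.inr σ, rfl⟩⟩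
      { p := p, K := ℚ_[p], galIso := ContinuousMulEquiv.refl _ } {q | q.Prime} := by
  haveI : T2Space (GQp p) := krullTopology_t2
  let E : FundamentalExtension.{0} := ⟨ProfiniteGrp.of (PiHtχ p), absoluteGaloisGrp ℚ_[p], augHatχ p,
    fun σ => ⟨SemidirectProduct.inr σ, rfl⟩⟩
  let B : E.MLFBase := { p := p, K := ℚ_[p], galIso := ContinuousMulEquiv.refl _ }
  change E.Thm26ii B {q | q.Prime}
  obtain ⟨e, -⟩ := exists_continuousMulEquiv_geom_chiTwisted p
  have hF : IsTopologicallyFinitelyGenerated F₂hatT :=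
    (IsProSigmaCompletion.isProSigmaCompletion_toCompletion F₂).isTopologicallyFinitelyGenerated_of_fg
  refine thm26ii_of_clauses B _ ?_ ?_ ?_
  · exact IsTopologicallyFinitelyGenerated.of_extension (augHatχ p)
      (fun σ => ⟨SemidirectProduct.inr σ, rfl⟩) (hF.of_continuousMulEquiv e) hG
  · intro l _ hl
    exact absurd (Fact.out : l.Prime) hl
  · intro l₁ l₂ _ _ _ _
    have h₁ : freeProlRank (GQp p) l₁ ≠ ⊤ := freeProlRank_gal_ne_top B l₁
    have h₂ : freeProlRank (GQp p) l₂ ≠ ⊤ := freeProlRank_gal_ne_top B l₂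
    change freeProlRank (PiHtχ p) l₁ - freeProlRank (GQp p) l₁ =
      freeProlRank (PiHtχ p) l₂ - freeProlRank (GQp p) l₂
    rw [freeProlRank_piHtχ p l₁, freeProlRank_piHtχ p l₂,
      (ENat.addLECancellable_of_ne_top h₁).add_tsub_cancel_left,
      (ENat.addLECancellable_of_ne_top h₂).add_tsub_cancel_left]

/-- **An extension with MLF base data and NON-TRIVIAL outer Galois action satisfying the typed
[AbsTopI] Thm 2.6 (ii) and (iv)** (given `G_{ℚ_p}` tfg for (ii)): the χ-twisted model, `Δ ≅ F̂₂ ≠ 1`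
and `δ¹_l(Π) = δ¹_l(G) + 1` (so `Π ≇ G` and `Π ≇ Δ × G`, whose rank difference would be `2`).
[cite: MochizukiAbsTopI2012, Thm 2.6 (ii) p.21] -/
theorem exists_thm26ii_thm26iv_rank_add_one (hG : IsTopologicallyFinitelyGenerated (GQp p)) :
    ∃ (E : FundamentalExtension.{0}) (B : E.MLFBase),
      E.Thm26ii B {q | q.Prime} ∧ E.Thm26iv {q | q.Prime} ∧
        ∀ (l : ℕ) [Fact l.Prime], freeProlRank E.arith l = freeProlRank E.gal l + 1 :=
  ⟨⟨ProfiniteGrp.of (PiHtχ p), absoluteGaloisGrp ℚ_[p], augHatχ p,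
      fun σ => ⟨SemidirectProduct.inr σ, rfl⟩⟩,
    { p := p, K := ℚ_[p], galIso := ContinuousMulEquiv.refl _ },
    thm26ii_chiTwistedModel_of_tfg p hG, thm26iv_chiTwistedModel p,
    fun l _ => freeProlRank_piHtχ p l⟩

end FundamentalExtension


end Literature.AnabelianGeometry.AbsoluteAnabelian

end
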